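import Literature.Topology.FourManifolds.SweepData
import Literature.Topology.FourManifolds.PDDifferential
import Literature.Topology.FourManifolds.ConeDifferentialComposite
import HarnessLib

/-!
# The conewise differentials of the two PD charts at a vertex of the triangulation

Topic `Literature/Topology/FourManifolds`; input of the link step of the vertex stage of the
smoothing sweep (Munkres, Ann. of Math. 72 (1960), §4–§5; Munkres (1966), Thm. 8.4;
Campbell–D'Onofrio–Vítek (2026), Lemma 3.2).  At a vertex cell `c` (simplex `{a}`, owner `j`) of a
good triangulation `S : SweepData n M c₁ c₂`, the PD charts `f = e₁ j ∘ (φ j).symm` and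
`f' = e₂ j ∘ (φ j).symm` (as open partial homeomorphisms of `ℝⁿ`) are conewise differentiable at
`a`, with the models of `S` on the simplices of the star:

* `SweepData.exists_coneDifferentials` — conewise differentials `L`, `L'` (positively
  homogeneous homeomorphisms bounded below) with the rescalings of `f`, `f'` at `a` converging to
  them uniformly on bounded sets (`PDDifferential.exists_homeomorph_coneDifferential`);
* `SweepData.exists_vertexCone` — consequences used by the vertex stage: (i) the rescalings of
  the transition `G = f' ∘ f.symm` at `z₁ = f a` converge to `L' ∘ L.symm` uniformly on bounded
  sets (`ConeDifferentialComposite.lean`), (ii) the RADIAL COMPARISON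
  `(μ/2) ‖q - a‖ ≤ ‖f q - f a‖ ≤ C ‖q - a‖` for `q` near `a` (from the same convergence), and the
  bound and lower bound of `L' ∘ L.symm`.

Everything is proved; no definitions; no named facts.

## References

* J. R. Munkres, *Obstructions to the smoothing of piecewise-differentiable homeomorphisms*, Ann.
  of Math. (2) 72 (1960), 521–554, §§4–5. [Munkres1960]
* J. R. Munkres, *Elementary differential topology* (1966), Thm. 8.4. [Munkres1966]
* D. Campbell, L. D'Onofrio, T. Vítek, *Diffeomorphic approximation of piecewise affine
  homeomorphisms*, J. Geom. Anal. 36 (2026), Lemma 3.2. [CampbellDonofrioVitek2026]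
-/

noncomputable section

open Set Function Metric Filter
open scoped Topology Manifold ContDiff

namespace Literature.Topology.FourManifolds

universe u

/-- Local notation: `𝔼 n` is the model Euclidean space `EuclideanSpace ℝ (Fin n)`. -/
local notation "𝔼 " n:arg => EuclideanSpace ℝ (Fin n)

variable {n : ℕ} {M : Type u} [TopologicalSpace M] {c₁ c₂ : ChartedSpace (𝔼 n) M}

namespace SweepData

variable (S : SweepData n M c₁ c₂)

/-- The first PD chart of the owner `j` as an open partial homeomorphism of `ℝⁿ`:
`(φ j).symm` followed by `e₁ j`. [folklore] -/
def pd₁ (j : S.ι) : OpenPartialHomeomorph (𝔼 n) (𝔼 n) := (S.φ j).symm.trans (S.e₁ j)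

/-- The second PD chart of the owner `j`. [folklore] -/
def pd₂ (j : S.ι) : OpenPartialHomeomorph (𝔼 n) (𝔼 n) := (S.φ j).symm.trans (S.e₂ j)

/-- Unfolding `pd₁`. [folklore] -/
theorem pd₁_apply (j : S.ι) (q : 𝔼 n) : S.pd₁ j q = S.e₁ j ((S.φ j).symm q) := rfl

/-- Unfolding `pd₂`. [folklore] -/
theorem pd₂_apply (j : S.ι) (q : 𝔼 n) : S.pd₂ j q = S.e₂ j ((S.φ j).symm q) := rfl

/-- The owner complex lies in the source of the first PD chart. [folklore] -/
theorem space_subset_pd₁_source (j : S.ι) : (S.K j).space ⊆ (S.pd₁ j).source := by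
  intro q hq
  simp only [pd₁, OpenPartialHomeomorph.trans_source, OpenPartialHomeomorph.symm_source, mem_inter_iff,
    mem_preimage]
  exact ⟨S.space_subset j hq, S.source₁ j ⟨q, hq, rfl⟩⟩

/-- The owner complex lies in the source of the second PD chart. [folklore] -/
theorem space_subset_pd₂_source (j : S.ι) : (S.K j).space ⊆ (S.pd₂ j).source := by
  intro q hq
  simp only [pd₂, OpenPartialHomeomorph.trans_source, OpenPartialHomeomorph.symm_source, mem_inter_iff,
    mem_preimage]
  exact ⟨S.space_subset j hq, S.source₂ j ⟨q, hq, rfl⟩⟩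

/-- **The conewise differentials of the two PD charts at a vertex.** [cite: Munkres1966, Thm. 8.4] -/
theorem exists_coneDifferentials (c : S.κ) {a : 𝔼 n} (hc : S.simplex c = {a}) :
    ∃ L L' : (𝔼 n) ≃ₜ 𝔼 n,
      (∀ (v : 𝔼 n) (t : ℝ), 0 ≤ t → L (t • v) = t • L v) ∧
      (∀ (v : 𝔼 n) (t : ℝ), 0 ≤ t → L' (t • v) = t • L' v) ∧
      (∃ μ > 0, ∀ v, μ * ‖v‖ ≤ ‖L v‖) ∧ (∃ μ' > 0, ∀ v, μ' * ‖v‖ ≤ ‖L' v‖) ∧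
      (∀ R : ℝ, TendstoUniformlyOn
        (fun (t : ℝ) (v : 𝔼 n) => t⁻¹ • (S.pd₁ (S.owner c) (a + t • v) - S.pd₁ (S.owner c) a)) L
        (𝓝[>] 0) (closedBall 0 R)) ∧
      (∀ R : ℝ, TendstoUniformlyOn
        (fun (t : ℝ) (v : 𝔼 n) => t⁻¹ • (S.pd₂ (S.owner c) (a + t • v) - S.pd₂ (S.owner c) a)) L'
        (𝓝[>] 0) (closedBall 0 R)) := by
  classical
  set j := S.owner c
  set K := S.K j with hK
  have hfin : K.faces.Finite := S.finite j
  have haK : a ∈ S.hull c := by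
    show a ∈ convexHull ℝ (S.simplex c : Set (𝔼 n))
    rw [hc]; simp
  have hnhds : K.space ∈ 𝓝 a :=
    mem_of_superset (isOpen_interior.mem_nhds (S.interior_owned c haK)) interior_subset
  -- top cofaces and models, as functions of the simplex
  have htop : ∀ s ∈ K.faces, ∃ t ∈ K.faces, s ⊆ t ∧ t.card = n + 1 := S.pure j
  choose! top htopK hstop hcard using htop
  have hm₁ : ∀ s ∈ K.faces, ∃ g : (𝔼 n) → 𝔼 n, ContDiff ℝ ∞ g ∧
      EqOn (S.e₁ j ∘ (S.φ j).symm) g (convexHull ℝ (top s : Set (𝔼 n))) ∧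
      ∀ x ∈ convexHull ℝ (top s : Set (𝔼 n)), Injective (fderiv ℝ g x) :=
    fun s hs => S.model₁ j (top s) (htopK s hs) (hcard s hs)
  have hm₂ : ∀ s ∈ K.faces, ∃ g : (𝔼 n) → 𝔼 n, ContDiff ℝ ∞ g ∧
      EqOn (S.e₂ j ∘ (S.φ j).symm) g (convexHull ℝ (top s : Set (𝔼 n))) ∧
      ∀ x ∈ convexHull ℝ (top s : Set (𝔼 n)), Injective (fderiv ℝ g x) :=
    fun s hs => S.model₂ j (top s) (htopK s hs) (hcard s hs)
  choose! g₁ hg₁ using hm₁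
  choose! g₂ hg₂ using hm₂
  have hsub : ∀ s ∈ K.faces, convexHull ℝ (s : Set (𝔼 n)) ⊆ convexHull ℝ (top s : Set (𝔼 n)) :=
    fun s hs => convexHull_mono (by exact_mod_cast hstop s hs)
  -- the two cone differentials
  obtain ⟨L, -, hLh, hLμ, hLconv⟩ := exists_homeomorph_coneDifferential rfl hfin
    (S.space_subset_pd₁_source j) hnhds (D := fun s => fderiv ℝ (g₁ s) a)
    (fun s hs has => ⟨(hg₁ s hs).2.2 a (hsub s hs has), g₁ s,
      (((hg₁ s hs).1.differentiable (by simp)) a).hasFDerivAt,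
      fun x hx => (hg₁ s hs).2.1 (hsub s hs hx)⟩)
  obtain ⟨L', -, hL'h, hL'μ, hL'conv⟩ := exists_homeomorph_coneDifferential rfl hfin
    (S.space_subset_pd₂_source j) hnhds (D := fun s => fderiv ℝ (g₂ s) a)
    (fun s hs has => ⟨(hg₂ s hs).2.2 a (hsub s hs has), g₂ s,
      (((hg₂ s hs).1.differentiable (by simp)) a).hasFDerivAt,
      fun x hx => (hg₂ s hs).2.1 (hsub s hs hx)⟩)
  exact ⟨L, L', hLh, hL'h, hLμ, hL'μ, hLconv, hL'conv⟩

/-- **The vertex cone**: the consequences used by the vertex stage.  With `f = pd₁`, `f' = pd₂`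
of the owner of the vertex cell `c` (simplex `{a}`) there are a positively homogeneous
homeomorphism `Λ` (the conewise differential of the transition `f' ∘ f.symm` at `f a`) with
`μ ‖w‖ ≤ ‖Λ w‖`, a radius `R₂ > 0` and constants `0 < κ₁ ≤ κ₂` such that
`κ₁ ‖q - a‖ ≤ ‖f q - f a‖ ≤ κ₂ ‖q - a‖` for `‖q - a‖ ≤ R₂`, and the rescalings of the transition
converge to `Λ` uniformly on bounded sets. [cite: CampbellDonofrioVitek2026, Lemma 3.2] -/
theorem exists_vertexCone (c : S.κ) {a : 𝔼 n} (hc : S.simplex c = {a}) :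
    ∃ (Λ : (𝔼 n) ≃ₜ 𝔼 n) (μ R₂ κ₁ κ₂ : ℝ),
      (∀ (w : 𝔼 n) (t : ℝ), 0 ≤ t → Λ (t • w) = t • Λ w) ∧ 0 < μ ∧ (∀ w, μ * ‖w‖ ≤ ‖Λ w‖) ∧
      0 < R₂ ∧ 0 < κ₁ ∧ κ₁ ≤ κ₂ ∧ closedBall a R₂ ⊆ (S.pd₁ (S.owner c)).source ∧
      (∀ q ∈ closedBall a R₂,
        κ₁ * ‖q - a‖ ≤ ‖S.pd₁ (S.owner c) q - S.pd₁ (S.owner c) a‖ ∧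
        ‖S.pd₁ (S.owner c) q - S.pd₁ (S.owner c) a‖ ≤ κ₂ * ‖q - a‖) ∧
      ∀ R : ℝ, TendstoUniformlyOn
        (fun (t : ℝ) (w : 𝔼 n) => t⁻¹ • (S.pd₂ (S.owner c) ((S.pd₁ (S.owner c)).symm
          (S.pd₁ (S.owner c) a + t • w)) - S.pd₂ (S.owner c) a))
        Λ (𝓝[>] 0) (closedBall 0 R) := by
  obtain ⟨L, L', hLh, hL'h, ⟨μ, hμ, hμL⟩, ⟨μ', hμ', hμ'L⟩, hLconv, hL'conv⟩ :=
    S.exists_coneDifferentials c hc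
  set j := S.owner c
  set f := S.pd₁ j with hf
  set f' := S.pd₂ j with hf'
  have haK : a ∈ (S.K j).space := by
    refine S.hull_subset_space c ?_
    show a ∈ convexHull ℝ (S.simplex c : Set (𝔼 n)); rw [hc]; simp
  have ha : a ∈ f.source := S.space_subset_pd₁_source j haK
  -- bounds of `L`, `L'`
  obtain ⟨ML, hML0, hML⟩ := exists_bound_of_posHomogeneous L.continuous hLh
  -- the composite
  set Λ : (𝔼 n) ≃ₜ 𝔼 n := L.symm.trans L' with hΛ
  have hΛapply : ∀ w, Λ w = L' (L.symm w) := fun w => rfl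
  have hΛh : ∀ (w : 𝔼 n) (t : ℝ), 0 ≤ t → Λ (t • w) = t • Λ w := by
    intro w t ht
    rw [hΛapply, hΛapply]
    have : L.symm (t • w) = t • L.symm w := by
      apply L.injective
      rw [L.apply_symm_apply, hLh _ _ ht, L.apply_symm_apply]
    rw [this, hL'h _ _ ht]
  have hΛμ : ∀ w, μ' / ML * ‖w‖ ≤ ‖Λ w‖ := by
    intro w
    rw [hΛapply]
    have h1 : ‖w‖ ≤ ML * ‖L.symm w‖ := by
      have := hML (L.symm w); rwa [L.apply_symm_apply] at this
    have h2 := hμ'L (L.symm w)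
    rw [div_mul_eq_mul_div, div_le_iff₀ hML0]
    nlinarith
  have hconv : ∀ R, TendstoUniformlyOn
      (fun (t : ℝ) (w : 𝔼 n) => t⁻¹ • (f' (f.symm (f a + t • w)) - f' a)) (L' ∘ L.symm)
      (𝓝[>] 0) (closedBall 0 R) :=
    tendstoUniformlyOn_rescale_comp_symm f ha f' L hLh L'.continuous hμ hμL hLconv hL'conv
  -- the radial comparison from the convergence on the unit ball
  have hev := (Metric.tendstoUniformlyOn_iff.1 (hLconv 1)) (μ / 2) (by positivity)
  have hsrc : ∀ᶠ t in 𝓝[>] (0 : ℝ), closedBall a t ⊆ f.source := by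
    obtain ⟨ρ, hρ, hρsub⟩ := Metric.mem_nhds_iff.1 (f.open_source.mem_nhds ha)
    have : ∀ᶠ t in 𝓝[>] (0 : ℝ), t < ρ := by
      have h : Iio ρ ∈ 𝓝 (0 : ℝ) := Iio_mem_nhds hρ
      exact mem_nhdsWithin_of_mem_nhds h
    filter_upwards [this] with t ht
    exact (closedBall_subset_ball ht).trans hρsub
  obtain ⟨t₀, ht₀, ht₀prop⟩ : ∃ t₀ > 0, ∀ t, 0 < t → t ≤ t₀ →
      (∀ v ∈ closedBall (0 : 𝔼 n) 1, dist (L v) (t⁻¹ • (f (a + t • v) - f a)) < μ / 2) ∧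
      closedBall a t ⊆ f.source := by
    have h := (hev.and hsrc)
    rw [eventually_nhdsWithin_iff, Metric.eventually_nhds_iff] at h
    obtain ⟨ε, hε, hball⟩ := h
    refine ⟨ε / 2, by positivity, fun t ht htε => hball ?_ ht⟩
    rw [Real.dist_eq, sub_zero, abs_of_pos ht]; linarith
  refine ⟨Λ, μ' / ML, t₀, μ / 2, ML + μ / 2, hΛh, by positivity, hΛμ, ht₀, by positivity,
    by linarith [hμ.le, hML0.le], (ht₀prop t₀ ht₀ le_rfl).2, fun q hq => ?_, ?_⟩
  · -- radial comparison at `q`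
    by_cases hqa : q = a
    · subst hqa; simp
    have ht : 0 < ‖q - a‖ := norm_pos_iff.2 (sub_ne_zero.2 hqa)
    set t := ‖q - a‖ with htdef
    set v : 𝔼 n := t⁻¹ • (q - a) with hv
    have hv1 : ‖v‖ = 1 := by rw [hv, norm_smul, norm_inv, norm_norm, inv_mul_cancel₀ ht.ne']
    have hqav : q = a + t • v := by
      rw [hv, smul_smul, mul_inv_cancel₀ ht.ne', one_smul]; abel
    have hclose := (ht₀prop t ht (mem_closedBall.1 hq |> fun h => by rwa [dist_eq_norm] at h)).1 v
      (by rw [mem_closedBall, dist_zero_right, hv1])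
    rw [← hqav] at hclose
    rw [dist_eq_norm] at hclose
    -- `‖f q - f a‖ = t * ‖t⁻¹ • (f q - f a)‖`
    have hscale : ‖f q - f a‖ = t * ‖t⁻¹ • (f q - f a)‖ := by
      rw [norm_smul, norm_inv, Real.norm_eq_abs, abs_of_pos ht, ← mul_assoc, mul_inv_cancel₀ ht.ne',
        one_mul]
    have hLv : μ ≤ ‖L v‖ := by have := hμL v; rwa [hv1, mul_one] at this
    have hLv' : ‖L v‖ ≤ ML := by have := hML v; rwa [hv1, mul_one] at this
    have hlow : ‖L v‖ - μ / 2 ≤ ‖t⁻¹ • (f q - f a)‖ := by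
      have := norm_sub_norm_le (L v) (t⁻¹ • (f q - f a)); linarith
    have hup : ‖t⁻¹ • (f q - f a)‖ ≤ ‖L v‖ + μ / 2 := by
      have := norm_sub_norm_le (t⁻¹ • (f q - f a)) (L v)
      rw [norm_sub_rev] at hclose; linarith
    constructor
    · rw [hscale]
      calc μ / 2 * t = t * (μ / 2) := by ring
        _ ≤ t * ‖t⁻¹ • (f q - f a)‖ := by gcongr; linarith
    · rw [hscale]
      calc t * ‖t⁻¹ • (f q - f a)‖ ≤ t * (ML + μ / 2) := by gcongr; linarith
        _ = (ML + μ / 2) * t := by ring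
  · intro R
    exact hconv R

end SweepData

end Literature.Topology.FourManifolds
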